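import Summits.BirchSwinnertonDyer.BirchSwinnertonDyer.Theorems.CumulativeHeegnerLeopoldtCumulativeHeegnerInclusionAtThreeResidualDevissage
import Literature.NumberTheory.EllipticCurves.KatoFineSelmerDualMuProofs
import Literature.GroupTheory.FiniteAbelian.HomCounts
import Literature.NumberTheory.IwasawaTheory.PruferPontryaginDual
import Literature.NumberTheory.EllipticCurves.IwasawaSelmerCoinvariantGrowthProofs
import HarnessLib

/-!
# Route `PrintCFram`, crux C2 `BottomClassIndexLawFiveLe` (stmt-BirchSwinnertonDyer-20372), line `eisenstein-resource-bdp-line`: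
# two COUNTING lemmas behind the λ-half of the Greenberg–Vatsal comparison —
# (i) the residual devissage with CARDINALITIES `#R(M) ≤ #R(Φ)·#R(M/Φ)` (CGLS Prop. 17 with counts),
# (ii) exactness of Pontryagin duality at `p` with CARDINALITIES `#(X/(p)X) ≤ #S[p]`
# (cell `bsd-print-cfram`, width seat `bsd-line-cfram-p1-w2` g3; helper `--supports` 20372; THEOREMS ONLY, 0 facts, 0 definitions)

HONEST FRAMING. Nothing about BSD is proved; no stub is closed. Generic group/Galois-cohomology bookkeeping, reduction-type-free,
sharpening the tree's FINITENESS statements (`CumulativeHeegnerInclusionAtThreeResidualDevissage.finite_residualSelmer_of_subquotient`,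
`IwasawaDual.finite_quotient_pSmul_of_finite_pTorsion`) to inequalities of `Nat.card`. Purpose: with the tree's `p^{λ(X)} ≤ #(X/pX)`
(`LambdaLowerBound.pow_lambdaInvariant_le_natCard_quotient`) and `#R(E[p]) = #Sel[p]` (`UniversalToricDescentResidualSelmerExact`), they give
`p^{λ(X_(∅,0))} ≤ #R(Φ)·#R(W[p]/Φ)` (companion file), i.e. the λ-side (AN-λ) of the analytic residual of `stub_invariantMatch_cmRamified`
becomes a statement about the two CHARACTER residual Selmer groups only.

* §1 `natCard_residualSelmer_le_mul_of_subquotient` / `…_of_stableSubgroup`: for `0 → Φ → M → Ψ → 0` as in the CHL devissage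
  (`q_*` maps `R(M)` into `R(Ψ)` with kernel inside `i_*(R(Φ))`): `#R(M) ≤ #R(Φ) · #R(Ψ)`.
* §2 `zmodAddEquivTorsionAddCircle`-free counting: `natCard_addMonoidHom_torsion_addCircle_eq` (`#Hom(G, (ℚ/ℤ)[p]) = #G` for a finite
  `p`-torsion `G`) and `IwasawaDual.natCard_quotient_pSmul_le_natCard_pTorsion`: for an axiomatic Pontryagin dual pair `(X, S)`,
  `#(X/(p)X) ≤ #S[p]` (the restriction of characters to `S[p]` factors through `X/(p)X` and is injective there).

References: Castella–Grossi–Lee–Skinner 2022 §3 Props. 17–18 [CastellaGrossiLeeSkinner2022]; Greenberg LNM 1716 §1 p. 60 [GreenbergLNM1716];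
Greenberg–Vatsal 2000 §2 Prop. (2.8) [GreenbergVatsal2000]; Hungerford, *Algebra* IV §4 [Hungerford1974].
-/

set_option autoImplicit false
-- the summit namespace `Summit.BirchSwinnertonDyer.BirchSwinnertonDyer` repeats the problem name by design (D-0017)
set_option linter.dupNamespace false

noncomputable section

open scoped Classical

namespace Summit.BirchSwinnertonDyer.BirchSwinnertonDyer.Theorems.PrintCFram.ResidualCounts

open NumberField IsDedekindDomain Field
  Literature.NumberTheory.EllipticCurves Literature.NumberTheory.EllipticCurves.GreenbergSelmer
  Literature.NumberTheory.EllipticCurves.GreenbergVatsal2000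
  Literature.NumberTheory.EllipticCurves.FineSelmerCoefficientMap
  Literature.NumberTheory.IwasawaTheory
  Literature.NumberTheory.GaloisRepresentations
  Summit.BirchSwinnertonDyer.Rank1Residual.X11b Summit.BirchSwinnertonDyer.Rank1Residual.X11b.AcSelmer
  Summit.BirchSwinnertonDyer.Rank1Residual.X2.ResidualDevissage
  Summit.BirchSwinnertonDyer.Rank1Residual.X2.ResidualDevissageSelmer
  Summit.BirchSwinnertonDyer.Rank1Residual.X2.ResidualDevissageModules
  Summit.BirchSwinnertonDyer.BirchSwinnertonDyer.Theorems.UniversalToricDescentResidualSelmer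
  Summit.BirchSwinnertonDyer.BirchSwinnertonDyer.Theorems.UniversalToricDescentResidualSelmerFinite
  Summit.BirchSwinnertonDyer.BirchSwinnertonDyer.Theorems.CumulativeHeegnerInclusionAtThreeResidualDevissage

universe u

/-! ## §1 The residual devissage with cardinalities -/

section Devissage

variable {K : Type u} [Field K] [NumberField K]
variable (H : Subgroup (absoluteGaloisGroup K)) [H.Normal]
variable {Φ : Type u} [AddCommGroup Φ] [DistribMulAction (absoluteGaloisGroup K) Φ]
  [TopologicalSpace Φ] [DiscreteTopology Φ]
variable {M : Type u} [AddCommGroup M] [DistribMulAction (absoluteGaloisGroup K) M]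
  [TopologicalSpace M] [DiscreteTopology M]
variable {Ψ : Type u} [AddCommGroup Ψ] [DistribMulAction (absoluteGaloisGroup K) Ψ]
  [TopologicalSpace Ψ] [DiscreteTopology Ψ]
variable {i : Φ →+ M} {hi : ∀ (g : absoluteGaloisGroup K) (x : Φ), i (g • x) = g • i x}
variable {q : M →+ Ψ}

/-- **The residual devissage, COUNTED (CGLS Prop. 17 with cardinalities).** In the setting of the tree's
`finite_residualSelmer_of_subquotient` (a short exact sequence `0 → Φ → M → Ψ → 0` of discrete `Γ_K`-modules, `H` normal, the strict
place `𝔭` with `Ψ^{H ⊓ D_𝔭} ⊆ q(M^{H ⊓ D_𝔭})`, finite residual Selmer groups of `Φ` and `Ψ`): `#R_𝔭^Σ(L, M) ≤ #R_𝔭^Σ(L, Φ) · #R_𝔭^Σ(L, Ψ)` —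
`q_*` maps `R(M)` into `R(Ψ)` and its kernel on `R(M)` lies in `i_*(R(Φ))`, so `#R(M) = #ker · #range ≤ #R(Φ) · #R(Ψ)`.
[cite: CastellaGrossiLeeSkinner2022, §3 (arXiv:2008.02571 §1, Prop. 17)] [cite: GreenbergVatsal2000, §2 p. 28 (display (16))] -/
theorem natCard_residualSelmer_le_mul_of_subquotient (p : ℕ) (𝔭 : HeightOneSpectrum (𝓞 K))
    (S₀ : Set (HeightOneSpectrum (𝓞 K)))
    (hi : ∀ (g : absoluteGaloisGroup K) (x : Φ), i (g • x) = g • i x)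
    (hq : ∀ (g : absoluteGaloisGroup K) (m : M), q (g • m) = g • q m)
    (hM : ∀ m : M, Continuous fun g : absoluteGaloisGroup K ↦ g • m)
    (hinj : Function.Injective i) (hqsurj : Function.Surjective q)
    (hexact : ∀ m, q m = 0 → m ∈ i.range) (hqi : ∀ x, q (i x) = 0)
    (hunr : ∀ v : HeightOneSpectrum (𝓞 K), v ∉ S₀ → ((p : ℕ) : 𝓞 K) ∉ v.asIdeal →
      ∀ x ∈ inertia v, ∀ m : M, x • m = m)
    (hfix : ∀ y : Ψ, (∀ g : ↥(H ⊓ decomp 𝔭), g • y = y) →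
      ∃ m : M, (∀ g : ↥(H ⊓ decomp 𝔭), g • m = m) ∧ q m = y)
    (hΦ : (datumStrictSelmer H Φ p (AcSelmer.bdpData Φ p 𝔭) S₀ : Set (subgroupH1 H Φ)).Finite)
    (hΨ : (datumStrictSelmer H Ψ p (AcSelmer.bdpData Ψ p 𝔭) S₀ : Set (subgroupH1 H Ψ)).Finite) :
    Nat.card (datumStrictSelmer H M p (AcSelmer.bdpData M p 𝔭) S₀) ≤
      Nat.card (datumStrictSelmer H Φ p (AcSelmer.bdpData Φ p 𝔭) S₀) *
        Nat.card (datumStrictSelmer H Ψ p (AcSelmer.bdpData Ψ p 𝔭) S₀) := by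
  set RM : AddSubgroup (subgroupH1 H M) := datumStrictSelmer H M p (AcSelmer.bdpData M p 𝔭) S₀ with hRM
  set RΦ : AddSubgroup (subgroupH1 H Φ) := datumStrictSelmer H Φ p (AcSelmer.bdpData Φ p 𝔭) S₀ with hRΦ
  set RΨ : AddSubgroup (subgroupH1 H Ψ) := datumStrictSelmer H Ψ p (AcSelmer.bdpData Ψ p 𝔭) S₀ with hRΨ
  haveI : Finite RΦ := hΦ.to_subtype
  haveI : Finite RΨ := hΨ.to_subtype
  let g : RM →+ subgroupH1 H Ψ := (subH1 H q hq).comp RM.subtype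
  -- the range of `g` lies in `R(Ψ)`
  have hrange : ∀ r : RM, g r ∈ RΨ := fun r ↦ by
    change subH1 H q hq (r : subgroupH1 H M) ∈ RΨ
    exact resH1Hom_id_mem_residualSelmer H p 𝔭 S₀ q hq (fun x m ↦ hq x m) r.2
  have h2 : Nat.card g.range ≤ Nat.card RΨ := by
    refine Nat.card_le_card_of_injective (fun y : g.range ↦ (⟨y.1, ?_⟩ : RΨ)) ?_
    · obtain ⟨r, hr⟩ := y.2
      rw [← hr]; exact hrange r
    · intro a b h
      have h' := congrArg (fun z : RΨ ↦ (z : subgroupH1 H Ψ)) h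
      exact Subtype.ext h'
  -- the kernel of `g` comes from `R(Φ)`
  have hex : ∀ r : g.ker, ∃ a : RΦ, subH1 H i hi a = ((r : RM) : subgroupH1 H M) := fun r ↦ by
    have hr0 : subH1 H q hq ((r : RM) : subgroupH1 H M) = 0 := (AddMonoidHom.mem_ker).1 r.2
    obtain ⟨a, ha, har⟩ := exists_mem_residualSelmer_subH1_eq H p 𝔭 S₀ (hi := hi) hq hM hinj
      hqsurj hexact hqi hunr hfix (r : RM).2 hr0
    exact ⟨⟨a, ha⟩, har⟩
  choose f hf using hex
  have h1 : Nat.card g.ker ≤ Nat.card RΦ := by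
    refine Nat.card_le_card_of_injective f fun r r' h ↦ ?_
    apply Subtype.ext
    apply Subtype.ext
    rw [← hf r, ← hf r', h]
  -- `#R(M) = #ker g · #range g`
  have h3 : Nat.card RM = Nat.card g.ker * Nat.card g.range := by
    rw [mul_comm, ← Nat.card_congr (QuotientAddGroup.quotientKerEquivRange g).toEquiv]
    exact AddSubgroup.card_eq_card_quotient_mul_card_addSubgroup g.ker
  rw [h3]
  exact Nat.mul_le_mul h1 h2

end Devissage

section Stable

variable {K : Type u} [Field K] [NumberField K]
variable (H : Subgroup (absoluteGaloisGroup K)) [H.Normal]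
variable {M : Type u} [AddCommGroup M] [DistribMulAction (absoluteGaloisGroup K) M]
  [TopologicalSpace M] [DiscreteTopology M]

/-- **The counted devissage along a stable subgroup `S ≤ M`** (`Φ = S`, `Ψ = M ⧸ S`, no non-zero `H ⊓ D_𝔭`-fixed vector in `M ⧸ S`):
`#R_𝔭^Σ(L, M) ≤ #R_𝔭^Σ(L, S) · #R_𝔭^Σ(L, M ⧸ S)`. [cite: CastellaGrossiLeeSkinner2022, §3 (arXiv:2008.02571 §1, Prop. 17)] -/
theorem natCard_residualSelmer_le_mul_of_stableSubgroup (p : ℕ) (𝔭 : HeightOneSpectrum (𝓞 K))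
    (S₀ : Set (HeightOneSpectrum (𝓞 K))) (S : StableSubgroup (absoluteGaloisGroup K) M)
    (hM : ∀ m : M, Continuous fun g : absoluteGaloisGroup K ↦ g • m)
    (hunr : ∀ v : HeightOneSpectrum (𝓞 K), v ∉ S₀ → ((p : ℕ) : 𝓞 K) ∉ v.asIdeal →
      ∀ x ∈ inertia v, ∀ m : M, x • m = m)
    (hfix : ∀ y : S.Quot, (∀ g : ↥(H ⊓ decomp 𝔭), g • y = y) → y = 0)
    (hΦ : (datumStrictSelmer H S.Sub p (AcSelmer.bdpData S.Sub p 𝔭) S₀ :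
      Set (subgroupH1 H S.Sub)).Finite)
    (hΨ : (datumStrictSelmer H S.Quot p (AcSelmer.bdpData S.Quot p 𝔭) S₀ :
      Set (subgroupH1 H S.Quot)).Finite) :
    Nat.card (datumStrictSelmer H M p (AcSelmer.bdpData M p 𝔭) S₀) ≤
      Nat.card (datumStrictSelmer H S.Sub p (AcSelmer.bdpData S.Sub p 𝔭) S₀) *
        Nat.card (datumStrictSelmer H S.Quot p (AcSelmer.bdpData S.Quot p 𝔭) S₀) :=
  natCard_residualSelmer_le_mul_of_subquotient H p 𝔭 S₀ (i := S.incl) (q := S.proj) S.incl_smul S.proj_smul hM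
    S.incl_injective S.proj_surjective S.mem_range_incl_of_proj_eq_zero S.proj_incl hunr
    (surjOn_fixed_of_forall_fixed_eq_zero S.proj hfix) hΦ hΨ

end Stable

/-! ## §2 Exactness of Pontryagin duality at `p`, with cardinalities: `#(X/(p)X) ≤ #S[p]` -/

section TorsionCircle

variable {p : ℕ} [hp : Fact p.Prime]

/-- **`(ℚ/ℤ)[p] ↪ ℤ/p` additively**: there is an injective additive map from the `p`-torsion of `ℚ/ℤ = AddCircle (1 : ℚ)` to
`ZMod (p^1)` (the classes are `a/p`, `a mod p` well defined: tree `QpModZp.addCircle_exists_eq_coe_int_div_of_nsmul_eq_zero`,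
`addCircle_coe_int_div_eq_coe_int_div_iff`). [cite: Hungerford1974, Ch. I §1 Exercise 10 (PDF p. 79)] -/
theorem exists_injective_addMonoidHom_torsion_addCircle :
    ∃ j : AddSubgroup.torsionBy (AddCircle (1 : ℚ)) ((p ^ 1 : ℕ) : ℤ) →+ ZMod (p ^ 1), Function.Injective j := by
  haveI : NeZero (p ^ 1) := ⟨pow_ne_zero _ hp.out.ne_zero⟩
  set Tp := AddSubgroup.torsionBy (AddCircle (1 : ℚ)) ((p ^ 1 : ℕ) : ℤ) with hTp
  have hp0 : (p : ℚ) ≠ 0 := Nat.cast_ne_zero.mpr hp.out.ne_zero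
  -- the map `ℤ → (ℚ/ℤ)[p]`, `a ↦ a/p`
  have hmem : ∀ a : ℤ, ((((a : ℚ) / (p : ℚ) ^ 1 : ℚ)) : AddCircle (1 : ℚ)) ∈ Tp := fun a ↦ by
    rw [hTp, AddSubgroup.torsionBy.nsmul_iff, ← AddCircle.coe_nsmul, AddCircle.coe_eq_zero_iff]
    refine ⟨a, ?_⟩
    rw [zsmul_eq_mul, mul_one, nsmul_eq_mul]
    push_cast
    rw [pow_one, mul_div_cancel₀ _ hp0]
  let f : ℤ →+ Tp :=
    { toFun := fun a ↦ ⟨_, hmem a⟩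
      map_zero' := Subtype.ext (by simp)
      map_add' := fun a b ↦ Subtype.ext (by
        change ((((a + b : ℤ) : ℚ) / (p : ℚ) ^ 1 : ℚ) : AddCircle (1 : ℚ)) =
          ((((a : ℚ) / (p : ℚ) ^ 1 : ℚ)) : AddCircle (1 : ℚ)) + ((((b : ℚ) / (p : ℚ) ^ 1 : ℚ)) : AddCircle (1 : ℚ))
        rw [← AddCircle.coe_add, Int.cast_add, add_div]) }
  have hf : ∀ a : ℤ, ((f a : Tp) : AddCircle (1 : ℚ)) = ((((a : ℚ) / (p : ℚ) ^ 1 : ℚ)) : AddCircle (1 : ℚ)) :=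
    fun _ ↦ rfl
  have hfp : f ((p ^ 1 : ℕ) : ℤ) = 0 := Subtype.ext (by
    rw [hf, ZeroMemClass.coe_zero]
    have h1 : ((((p ^ 1 : ℕ) : ℤ) : ℚ) / (p : ℚ) ^ 1 : ℚ) = 1 := by
      push_cast
      exact div_self (pow_ne_zero _ hp0)
    rw [h1, AddCircle.coe_period])
  let e : ZMod (p ^ 1) →+ Tp := ZMod.lift (p ^ 1) ⟨f, by exact_mod_cast hfp⟩
  have he : ∀ a : ℤ, e (a : ZMod (p ^ 1)) = f a := fun a ↦ ZMod.lift_coe (p ^ 1) _ a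
  -- `e` is bijective
  have hinj : Function.Injective e := by
    intro x y hxy
    obtain ⟨a, rfl⟩ := ZMod.intCast_surjective x
    obtain ⟨b, rfl⟩ := ZMod.intCast_surjective y
    rw [he, he] at hxy
    have h := congrArg (fun t : Tp ↦ (t : AddCircle (1 : ℚ))) hxy
    simp only [hf] at h
    exact QpModZp.addCircle_coe_int_div_eq_coe_int_div_iff.mp h
  have hsurj : Function.Surjective e := by
    intro u
    have hu : p ^ 1 • (u : AddCircle (1 : ℚ)) = 0 := by
      have := AddSubgroup.torsionBy.nsmul_iff.mp u.2
      exact this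
    obtain ⟨a, ha⟩ := QpModZp.addCircle_exists_eq_coe_int_div_of_nsmul_eq_zero hu
    exact ⟨(a : ZMod (p ^ 1)), Subtype.ext (by rw [he, hf, ← ha])⟩
  let E : ZMod (p ^ 1) ≃+ Tp := AddEquiv.ofBijective e ⟨hinj, hsurj⟩
  exact ⟨E.symm.toAddMonoidHom, E.symm.injective⟩

/-- **`#Hom(G, (ℚ/ℤ)[p]) ≤ #G`** for a finite abelian `p`-torsion group `G` (through `(ℚ/ℤ)[p] ↪ ℤ/p` and the tree's
`|Hom(G, ℤ/n)| = |G[n]|`). [cite: Hungerford1974, Ch. IV §4 Exercise 1 (a) (PDF p. 283)] -/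
theorem natCard_addMonoidHom_torsion_addCircle_le (G : Type*) [AddCommGroup G] [Finite G] :
    Nat.card (G →+ AddSubgroup.torsionBy (AddCircle (1 : ℚ)) ((p ^ 1 : ℕ) : ℤ)) ≤ Nat.card G := by
  haveI : NeZero (p ^ 1) := ⟨pow_ne_zero _ hp.out.ne_zero⟩
  obtain ⟨j, hj⟩ := exists_injective_addMonoidHom_torsion_addCircle (p := p)
  haveI : Finite (G →+ ZMod (p ^ 1)) := Finite.of_injective (fun g : G →+ ZMod (p ^ 1) ↦ (g : G → ZMod (p ^ 1)))
    DFunLike.coe_injective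
  calc Nat.card (G →+ AddSubgroup.torsionBy (AddCircle (1 : ℚ)) ((p ^ 1 : ℕ) : ℤ))
      ≤ Nat.card (G →+ ZMod (p ^ 1)) := by
        refine Nat.card_le_card_of_injective (fun g ↦ j.comp g) fun g g' h ↦ ?_
        ext x
        have := congrArg (fun φ : G →+ ZMod (p ^ 1) ↦ φ x) h
        exact congrArg Subtype.val (hj this)
    _ = Nat.card (AddSubgroup.torsionBy G ((p ^ 1 : ℕ) : ℤ)) :=
        Literature.GroupTheory.FiniteAbelian.natCard_addMonoidHom_zmod_right G (p ^ 1)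
    _ ≤ Nat.card G := Nat.card_le_card_of_injective _ Subtype.val_injective

end TorsionCircle

namespace IwasawaDualCount

variable {p : ℕ} [hp : Fact p.Prime]
variable {S : Type*} [AddCommGroup S]
variable {X : Type*} [AddCommGroup X] [Module (PowerSeries ℤ_[p]) X]
variable {toDual : X →+ (S →+ AddCircle (1 : ℚ))}

/-- **Exactness of Pontryagin duality at `p`, COUNTED: `#(X/(p)X) ≤ #S[p]`.** For an axiomatic Pontryagin dual pair (`toDual`
bijective, constants through `ℤ_p → ℤ/p^k`, `S` `p`-primary) with `S[p]` finite: restriction of characters to `S[p]` factors through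
`X/(p)X` (characters of `(p)X` kill `S[p]`), injectively (a character killing `S[p]` is `C(p)` times a character, tree
`IwasawaDual.exists_eq_C_p_smul_of_forall_pTorsion`), with values in `Hom(S[p], (ℚ/ℤ)[p])`, which has at most `#S[p]` elements.
The tree's `finite_quotient_pSmul_of_finite_pTorsion` is the finiteness shadow. [cite: GreenbergLNM1716, §1 p. 60 (after Conj. 1.3)]
[cite: GreenbergVatsal2000, §2 Prop. (2.8)] -/
theorem natCard_quotient_pSmul_le_natCard_pTorsion (hbij : Function.Bijective toDual)
    (hC : ∀ (c : ℤ_[p]) (x : X) (s : S) (k : ℕ), p ^ k • s = 0 →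
      toDual (PowerSeries.C c • x) s = (PadicInt.toZModPow k c).val • toDual x s)
    (htor : ∀ s : S, ∃ k : ℕ, p ^ k • s = 0) (hfin : {s : S | p • s = 0}.Finite) :
    Nat.card (X ⧸ (Ideal.span {PowerSeries.C (p : ℤ_[p])} • ⊤ : Submodule (PowerSeries ℤ_[p]) X)) ≤
      Nat.card {s : S // p • s = 0} := by
  classical
  set Sp : AddSubgroup S := AddSubgroup.torsionBy S ((p ^ 1 : ℕ) : ℤ) with hSp
  set Tp : AddSubgroup (AddCircle (1 : ℚ)) := AddSubgroup.torsionBy (AddCircle (1 : ℚ)) ((p ^ 1 : ℕ) : ℤ) with hTp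
  have hSpmem : ∀ s : S, s ∈ Sp ↔ p • s = 0 := fun s ↦ by
    rw [hSp, AddSubgroup.torsionBy.nsmul_iff, pow_one]
  haveI : Finite Sp := by
    have h : (Sp : Set S) = {s : S | p • s = 0} := Set.ext fun s ↦ hSpmem s
    have : (Sp : Set S).Finite := by rw [h]; exact hfin
    exact this.to_subtype
  set N : Submodule (PowerSeries ℤ_[p]) X := Ideal.span {PowerSeries.C (p : ℤ_[p])} • ⊤ with hN
  -- the restriction map `ρ : X → Hom(S[p], (ℚ/ℤ)[p])`
  have hval : ∀ (x : X) (s : Sp), toDual x s ∈ Tp := fun x s ↦ by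
    rw [hTp, AddSubgroup.torsionBy.nsmul_iff, pow_one, ← map_nsmul, (hSpmem s).mp s.2, map_zero]
  let ρ : X →+ (Sp →+ Tp) :=
    { toFun := fun x ↦
        { toFun := fun s ↦ ⟨toDual x s, hval x s⟩
          map_zero' := Subtype.ext (by simp)
          map_add' := fun s t ↦ Subtype.ext (by simp) }
      map_zero' := by ext s; simp
      map_add' := fun x y ↦ by ext s; simp }
  have hρ : ∀ (x : X) (s : Sp), ((ρ x s : Tp) : AddCircle (1 : ℚ)) = toDual x s := fun _ _ ↦ rfl
  -- characters of `N = (p)·X` kill `S[p]`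
  have hNann : ∀ z ∈ N, ∀ s : Sp, toDual z (s : S) = 0 := by
    intro z hz s
    rw [hN] at hz
    refine Submodule.smul_induction_on hz (fun a ha n _ ↦ ?_) (fun a b ha hb ↦ ?_)
    · obtain ⟨r, rfl⟩ := Ideal.mem_span_singleton'.mp ha
      rw [mul_comm, mul_smul, hC (p : ℤ_[p]) (r • n) s 1 (by rw [pow_one]; exact (hSpmem s).mp s.2)]
      have h0 : (PadicInt.toZModPow 1 (p : ℤ_[p])).val = 0 := by
        rw [map_natCast, ZMod.val_natCast, pow_one, Nat.mod_self]
      rw [h0, zero_smul]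
    · rw [map_add, AddMonoidHom.add_apply, ha, hb, add_zero]
  have hρN : ∀ x y : X, x - y ∈ N → ρ x = ρ y := by
    intro x y hxy
    ext s
    rw [hρ, hρ, ← sub_eq_zero, ← AddMonoidHom.sub_apply, ← map_sub]
    exact hNann _ hxy s
  -- the factorisation through `X ⧸ N` and its injectivity
  let F : X ⧸ N → (Sp →+ Tp) := fun q ↦ Quotient.liftOn' q ρ fun x y hxy ↦ hρN x y ((Submodule.quotientRel_def N).mp hxy)
  have hF : Function.Injective F := by
    intro q₁ q₂ hq
    induction q₁ using Quotient.inductionOn' with | h x => ?_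
    induction q₂ using Quotient.inductionOn' with | h y => ?_
    change ρ x = ρ y at hq
    apply (Submodule.Quotient.eq N).mpr
    have hann : ∀ s : S, p • s = 0 → toDual (x - y) s = 0 := by
      intro s hs
      have h := congrArg (fun φ : Sp →+ Tp ↦ ((φ ⟨s, (hSpmem s).mpr hs⟩ : Tp) : AddCircle (1 : ℚ))) hq
      simp only [hρ] at h
      rw [map_sub, AddMonoidHom.sub_apply, h, sub_self]
    obtain ⟨x', hx'⟩ := IwasawaDual.exists_eq_C_p_smul_of_forall_pTorsion hbij hC htor hann
    rw [hx', hN]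
    exact Submodule.smul_mem_smul (Ideal.mem_span_singleton_self _) Submodule.mem_top
  -- counting
  haveI : Finite Tp := by
    have h := (IwasawaDual.finite_and_natCard_addCircle_torsion_le (pow_pos hp.out.pos 1)).1
    have hset : (Tp : Set (AddCircle (1 : ℚ))) = {q : AddCircle (1 : ℚ) | p ^ 1 • q = 0} :=
      Set.ext fun q ↦ by rw [hTp, SetLike.mem_coe, AddSubgroup.torsionBy.nsmul_iff]; rfl
    have : (Tp : Set (AddCircle (1 : ℚ))).Finite := by rw [hset]; exact h
    exact this.to_subtype
  haveI : Finite (Sp →+ Tp) := Finite.of_injective (fun g : Sp →+ Tp ↦ (g : Sp → Tp)) DFunLike.coe_injective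
  calc Nat.card (X ⧸ N) ≤ Nat.card (Sp →+ Tp) := Nat.card_le_card_of_injective F hF
    _ ≤ Nat.card Sp := natCard_addMonoidHom_torsion_addCircle_le (p := p) Sp
    _ = Nat.card {s : S // p • s = 0} := Nat.card_congr (Equiv.subtypeEquivRight fun s ↦ hSpmem s)

end IwasawaDualCount

end Summit.BirchSwinnertonDyer.BirchSwinnertonDyer.Theorems.PrintCFram.ResidualCounts

end
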